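import Summits.CriticalPhenomena.CardyFormulaZ2.Theses.CardyBoundaryCoulombGas
import Summits.CriticalPhenomena.CardyFormulaZ2.Theorems.RectilinearCardy.Negative.RectilinearCardySquareInstance
import Summits.CriticalPhenomena.CardyFormulaZ2.Theorems.CardyBoundaryCoulombGasRectilinearCardyClosureDefs
import Summits.CriticalPhenomena.CardyFormulaZ2.Theorems.CardyBoundaryCoulombGasRectilinearCardyIffCubeRootLawPart1
import Summits.CriticalPhenomena.CardyFormulaZ2.Theorems.CardyBoundaryCoulombGasRectilinearCardyStubFiniteCorners
import Summits.CriticalPhenomena.CardyFormulaZ2.Theorems.CardyBoundaryCoulombGasRectilinearCardyLocalToGlobal2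
import Summits.CriticalPhenomena.CardyFormulaZ2.Theorems.CardyBoundaryCoulombGasRectilinearCardyUniformFlatRadius
import Summits.CriticalPhenomena.CardyFormulaZ2.Theorems.CardyBoundaryCoulombGasRectilinearCardyStubBoundaryCorrespondence
import Summits.CriticalPhenomena.CardyFormulaZ2.Theorems.CardyBoundaryCoulombGasRectilinearCardyStubContinuumTail
import Summits.CriticalPhenomena.CardyFormulaZ2.Theorems.CardyBoundaryCoulombGasRectilinearCardyStubSchwarzExtension
import Summits.CriticalPhenomena.CardyFormulaZ2.Theorems.CardyBoundaryCoulombGasRectilinearCardyStubDensityWindowLaw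
import Summits.CriticalPhenomena.CardyFormulaZ2.Theorems.CardyBoundaryCoulombGasRectilinearCardyStubDensityPartition
import Summits.CriticalPhenomena.CardyFormulaZ2.Theorems.CardyBoundaryCoulombGasRectilinearCardyStubClosureJunction
import Summits.CriticalPhenomena.CardyFormulaZ2.Theorems.CardyBoundaryCoulombGasRectilinearCardyStubClosureOneArm
import Summits.CriticalPhenomena.CardyFormulaZ2.Theorems.CardyBoundaryCoulombGasRectilinearCardyStubClosureFlatMarksReduction
import Summits.CriticalPhenomena.CardyFormulaZ2.Theorems.CardyBoundaryCoulombGasRectilinearCardyStubClosureToConjunct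
import Literature.Probability.RandomPlanarGeometry.CardyFunctionIncBeta
import Literature.Probability.RandomPlanarGeometry.ConformalRectangleProofs
import HarnessLib

/-!
# Line `excursion-kernel-covariance` of crux `RectilinearCardy` (stmt-CriticalPhenomena-5660): the crux
# from the CLOSURE DENSITY LAW (the composition of the line skeleton, landed)

`rectilinearCardy_of_closureDensityAsymptoticsG`: the crux
`Summit.CriticalPhenomena.CardyFormulaZ2.Theses.CardyBoundaryCoulombGas.RectilinearCardy` follows from the
line's lever — the closure density law, uniform on flat windows, for charts of the Schwarz class (the
statement `ClosureDensityAsymptoticsG` of the skeleton `Lines/excursion_kernel_covariance.lean`, written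
out) — and NOTHING ELSE: every other ingredient is a landed stub of the line (`stub_densityWindowLaw`,
`stub_densityPartition`, `stub_closureJunction`, `stub_closureOneArm`, `stub_boundaryCorrespondence`,
`stub_continuumTail`, `stub_schwarzExtension`, `stub_closureFlatMarksReduction`, `stub_closureToConjunct`).
This is the skeleton's composition `closureCardy_of_flatMarks` + `RectilinearCardy_of`, moved to the tree
verbatim (helpers primed to avoid clashing with the workfile; `doubleRatio_transfer`,
`eventually_abs_sub_le_of_tendsto` are the landed copies of `…IffCubeRootLawPart1`). The lever itself is
`stub_uniformiseG (stub_pointwiseFromEngineG ENGINE latticeBridge)`; see `…RectilinearCardyDensityIntegration`.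
-/

open Set Filter Topology MeasureTheory
open Literature.Probability.RandomPlanarGeometry
open Literature.Probability.Percolation (bondDomainCrossingProb discreteCrossingProb half)
open Literature.Probability.LatticeModels (Site meshPoint meshDomain meshBoundary discreteArc
  meshDomain_finite meshVertices meshVertices_finite zdGraph)
open Summit.CriticalPhenomena.CardyFormulaZ2.Theorems.RectilinearCardy.Negative (IsRectilinear)
open Summit.CriticalPhenomena.CardyFormulaZ2.Theses.CardyBoundaryCoulombGas (RectilinearCardy
  BoundaryDefectGaussianR)
open UpperHalfPlane (upperHalfPlaneSet)

namespace Summit.CriticalPhenomena.CardyFormulaZ2.Cruxes.RectilinearCardy.ExcursionKernelCovariance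

/-- **`Q^cl_δ(mark 1) → 1`** from the junction estimate (at `s' = mark 1` the complement arc is the
point `b`). [folklore] -/
theorem tendsto_closureTailProb_mark_one' (R : ConformalRectangle)
    (hR : IsRectilinear R) (hF : FlatMarks R) :
    Tendsto (fun δ => closureTailProb R δ (R.mark 1)) (𝓝[>] 0) (𝓝 1) := by
  have h13 : R.mark 1 ≤ R.mark 3 := (R.strictMono_mark (show (1 : Fin 4) < 3 by decide)).le
  refine tendsto_order.2 ⟨fun x hx => ?_, fun x hx => Eventually.of_forall fun δ =>
    lt_of_le_of_lt (closureTailProb_mem_Icc R δ _).2 hx⟩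
  obtain ⟨lam, hlam, hev⟩ := stub_closureJunction R hR hF ((1 - x) / 2) (by linarith)
  filter_upwards [hev] with δ hδ
  have := hδ (R.mark 1) le_rfl h13 fun t ht => by
    rw [show t = R.mark 1 by linarith [ht.1, ht.2]]
    show dist (R.pt 1) (R.pt 1) ≤ lam
    rw [dist_self]; exact hlam.le
  linarith

/-- **The Schwarz chart's boundary function.** If `w` is holomorphic on an open `U`, agrees with
`φ⁻¹` on `Ω` (`φ : ℍ → Ω` conformal) and `φ` has boundary value `∂Ω(t)` at the real point `x`, then
`w (∂Ω(t)) = x` whenever `∂Ω(t) ∈ U`: along `z → x` within `ℍ`, `w (φ z) = z → x` while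
`w (φ z) → w (∂Ω(t))` by continuity. [folklore] -/
theorem chart_boundary_eq' (R : ConformalRectangle) (φ : ConformalEquiv upperHalfPlaneSet R.carrier)
    {U : Set ℂ} {w : ℂ → ℂ} (hUo : IsOpen U) (hwd : DifferentiableOn ℂ w U)
    (hwφ : EqOn w φ.symm R.carrier) {x : ℝ} {t : ℝ} (hbv : φ.HasBoundaryValue x (R.boundary t))
    (htU : R.boundary t ∈ U) : w (R.boundary t) = x := by
  haveI : (𝓝[upperHalfPlaneSet] (x : ℂ)).NeBot := by
    refine mem_closure_iff_nhdsWithin_neBot.1 ?_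
    have : closure upperHalfPlaneSet = {z : ℂ | 0 ≤ z.im} := Complex.closure_setOf_lt_im 0
    rw [this]
    simp
  have h1 : Tendsto (w ∘ φ) (𝓝[upperHalfPlaneSet] (x : ℂ)) (𝓝 (w (R.boundary t))) :=
    ((hwd.continuousOn.continuousAt (hUo.mem_nhds htU)).tendsto).comp hbv
  have h2 : (w ∘ φ) =ᶠ[𝓝[upperHalfPlaneSet] (x : ℂ)] id := by
    filter_upwards [self_mem_nhdsWithin] with z hz
    show w (φ z) = z
    rw [hwφ (φ.mapsTo hz), φ.symm_apply_apply hz]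
  have h3 : Tendsto (id : ℂ → ℂ) (𝓝[upperHalfPlaneSet] (x : ℂ)) (𝓝 (w (R.boundary t))) := h1.congr' h2
  have h4 : Tendsto (id : ℂ → ℂ) (𝓝[upperHalfPlaneSet] (x : ℂ)) (𝓝 (x : ℂ)) :=
    tendsto_id.mono_left nhdsWithin_le_nhds
  exact_mod_cast (tendsto_nhds_unique h3 h4)

/-- **The closure density law implies Cardy's formula in the closure discretisation on flat-marked
rectilinear polygons** (the glue, fully proved): `localToGlobal_abstract` with `Q := closureTailProb R`
and the constant-in-`δ` comparison family `ν δ := contTail R g` (`g` from `BoundaryCorrespondence`, its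
properties from `ContinuumTail`); the double-ratio hypothesis is the density window law
(`SchwarzExtension` ⇒ chart, `chart_boundary_eq` ⇒ its boundary function, `ClosureDensityAsymptoticsG` ⇒ point asymptotics, `DensityWindowLaw` ⇒
`c δ Δ densityMass → ΔC`, `DensityPartition` ⇒ `Δ densityMass = ΔQ^cl`) transported by
`doubleRatio_transfer` with the trivial law; tightness is `ClosureJunction` + `ClosureOneArm`; at
`s = mark 2`, `closureCrossingProb R δ → F(crossRatio x)` for the uniformizing datum `x i = g (mark i)`;
datum-independence of the cross-ratio finishes. [folklore] -/
theorem closureCardy_of_flatMarks'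
    (hA : ∀ R : ConformalRectangle, IsRectilinear R → FlatMarks R →
        ∀ (U : Set ℂ) (w : ℂ → ℂ), IsOpen U → R.carrier ⊆ U →
          R.pt 0 ∈ U → R.pt 1 ∈ U → R.pt 3 ∈ U →
          DifferentiableOn ℂ w U → BijOn w R.carrier {z : ℂ | 0 < z.im} →
          ∀ (g : ℝ → ℝ) (S₀ S : ℝ), S₀ < 0 → R.mark 3 < S →
            (StrictMonoOn g (Icc S₀ S) ∨ StrictAntiOn g (Icc S₀ S)) →
            (∀ t ∈ Icc S₀ S, R.boundary t ∈ U → w (R.boundary t) = g t) →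
          ∃ N : ℝ → ℝ, (∀ δ, 0 < N δ) ∧
            ∀ σ σ' : ℝ, AdmissibleRange R σ σ' → R.boundary '' Icc σ σ' ⊆ U →
              (∀ τ ∈ Icc σ σ', w (R.boundary τ) ≠ w (R.pt 0) ∧ w (R.boundary τ) ≠ w (R.pt 1) ∧
                w (R.boundary τ) ≠ w (R.pt 3)) →
              ∀ ε : ℝ, 0 < ε → ∀ᶠ δ in 𝓝[>] (0 : ℝ), ∀ v ∈ boundaryRow R δ, ∀ τ ∈ Icc σ σ',
                dist (meshPoint δ v) (R.boundary τ) ≤ 4 * δ →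
                  |closureDensity R δ v / (δ * N δ) -
                      ‖deriv w (R.boundary τ)‖ *
                        (‖w (R.boundary τ) - w (R.pt 0)‖ ^ 2 * ‖w (R.boundary τ) - w (R.pt 1)‖ ^ 2 *
                            ‖w (R.boundary τ) - w (R.pt 3)‖ ^ 2) ^ (-(1 / 3 : ℝ))| ≤ ε) :
    ∀ R : ConformalRectangle, IsRectilinear R → FlatMarks R →
      R.HasCrossingLimit (closureCrossingProb R) cardyFunction := by
  intro R hR hF φ' x' hφx'
  obtain ⟨φ, g, S₀, S, w₀, hS₀, h3S, hS1, hSS₀, hgc, hgm, hbv, hw₀φ, hw₀c, hw₀g⟩ := stub_boundaryCorrespondence R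
  -- restriction of the datum to `[0, mark 3]`
  have hsub : Icc (0 : ℝ) (R.mark 3) ⊆ Icc S₀ S := Icc_subset_Icc hS₀.le h3S.le
  have hgc' : ContinuousOn g (Icc 0 (R.mark 3)) := hgc.mono hsub
  have hgm' : StrictMonoOn g (Icc 0 (R.mark 3)) ∨ StrictAntiOn g (Icc 0 (R.mark 3)) :=
    hgm.imp (fun h => h.mono hsub) (fun h => h.mono hsub)
  obtain ⟨hCc, hCa, hC1, hC3, hCt⟩ := stub_continuumTail R g hgc' hgm'
  obtain ⟨U, w, hUo, hΩU, hflatU, hwd, hwbij, hwφ⟩ :=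
    stub_schwarzExtension R φ g S₀ S w₀ hS₀ h3S hS1 hSS₀ hgc hgm hbv hw₀φ hw₀c hw₀g
  have hmI : ∀ i : Fin 4, R.mark i ∈ Icc (0 : ℝ) (R.mark 3) := fun i =>
    ⟨(R.mark_mem i).1, R.strictMono_mark.monotone (Fin.le_last i)⟩
  have hptU : ∀ i : Fin 4, R.pt i ∈ U ∧ w (R.pt i) = g (R.mark i) := fun i =>
    hflatU (R.mark i) (hmI i) (hF i)
  -- the chart's boundary function is `g` wherever the loop enters `U` (boundary correspondence)
  have hwg : ∀ t ∈ Icc S₀ S, R.boundary t ∈ U → w (R.boundary t) = g t := fun t ht htU =>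
    chart_boundary_eq' R φ hUo hwd hwφ (hbv t ht) htU
  obtain ⟨N, hNpos, hN⟩ := hA R hR hF U w hUo hΩU (hptU 0).1 (hptU 1).1 (hptU 3).1 hwd hwbij
    g S₀ S hS₀ h3S hgm hwg
  obtain ⟨c, hcpos, hclaw⟩ := stub_densityWindowLaw R hR hF φ g S₀ S w₀ hS₀ h3S hS1 hSS₀ hgc hgm hbv hw₀φ hw₀c hw₀g
    U w hUo hΩU hflatU hwd hwbij hwφ N hNpos hN
  obtain ⟨T, hT⟩ := stub_finiteCorners R hR
  have hQ1 := tendsto_closureTailProb_mark_one' R hR hF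
  obtain ⟨hQtight, hQ3⟩ := stub_closureOneArm R hR hF (stub_closureJunction R hR hF)
  have h13 : R.mark 1 < R.mark 3 := R.strictMono_mark (show (1 : Fin 4) < 3 by decide)
  -- the uniformizing datum read off the boundary correspondence
  set x : Fin 4 → ℝ := fun i => g (R.mark i) with hx
  have hU : R.IsUniformizing φ x := by
    refine ⟨?_, fun i => hbv _ (hsub (hmI i))⟩
    exact hgm'.imp (fun h a b hab => h (hmI a) (hmI b) (R.strictMono_mark hab))
      (fun h a b hab => h (hmI a) (hmI b) (R.strictMono_mark hab))
  -- the glue: `Q^cl_δ(s) - C(s) → 0` for every `s`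
  have key : ∀ s ∈ Icc (R.mark 1) (R.mark 3),
      Tendsto (fun δ => closureTailProb R δ s - contTail R g s) (𝓝[>] 0) (𝓝 0) := by
    refine localToGlobal_abstract (Q := fun δ s => closureTailProb R δ s)
      (ν := fun _ s => contTail R g s)
      (Good := fun s => ∃ r : ℝ, 0 < r ∧ FlatNear R (R.boundary s) r) (Adm := AdmissibleRange R)
      h13 R.continuous_boundary T hT ?_ ?_ ?_ ?_ ?_ hQ1 hQ3 ?_ ?_ ?_ ?_
    · intro σ σ' hσ hσσ' hσ' hgood
      exact ⟨hσ, hσσ', hσ', exists_uniform_flatRadius R hgood⟩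
    · exact Eventually.of_forall fun δ => closureTailProb_antitoneOn R δ
    · exact Eventually.of_forall fun δ => hCa.antitoneOn
    · exact Eventually.of_forall fun δ => (closureTailProb_mem_Icc R δ _).2
    · exact Eventually.of_forall fun δ => hC1
    · simpa only [contTail, hC3] using tendsto_const_nhds
    · exact hQtight
    · intro ε hε
      obtain ⟨ρ, hρ, h⟩ := hCt ε hε
      exact ⟨ρ, hρ, Eventually.of_forall fun δ => h⟩
    · -- the double-ratio law for `(Q^cl, C)`: the density window law, transported
      intro σ σ' τ τ' hσ hτ ε hε s s' t t' hs hss' hs' ht htt' ht'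
      set ε₀ : ℝ := min 1 (ε / 3) with hε₀
      have hε₀pos : 0 < ε₀ := lt_min one_pos (by linarith)
      have hε₀1 : ε₀ ≤ 1 := min_le_left _ _
      have hε₀3 : 3 * ε₀ ≤ ε := by
        have := min_le_right 1 (ε / 3); linarith
      have hCs : 0 ≤ contTail R g s - contTail R g s' :=
        sub_nonneg.2 (hCa.antitoneOn ⟨hσ.1.le.trans hs, hss'.trans (hs'.trans hσ.2.2.1.le)⟩
          ⟨hσ.1.le.trans (hs.trans hss'), hs'.trans hσ.2.2.1.le⟩ hss')
      have hCt' : 0 ≤ contTail R g t - contTail R g t' :=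
        sub_nonneg.2 (hCa.antitoneOn ⟨hτ.1.le.trans ht, htt'.trans (ht'.trans hτ.2.2.1.le)⟩
          ⟨hτ.1.le.trans (ht.trans htt'), ht'.trans hτ.2.2.1.le⟩ htt')
      -- `c δ ΔQ^cl → ΔC` on both windows (window law + partition identity)
      have hwin : ∀ {p p' : ℝ} {π π' : ℝ}, AdmissibleRange R π π' → π ≤ p → p ≤ p' → p' ≤ π' →
          Tendsto (fun δ => c δ * (closureTailProb R δ p - closureTailProb R δ p')) (𝓝[>] 0)
            (𝓝 (contTail R g p - contTail R g p')) := by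
        intro p p' π π' hπ hp hpp' hp'
        have h1 := hclaw π π' hπ p p' hp hpp' hp'
        have h2 := stub_densityPartition R hR π π' hπ p p' hp hpp' hp'
        refine (h1.congr' ?_)
        filter_upwards [h2] with δ hδ
        show c δ * (densityMass R δ p - densityMass R δ p') =
          c δ * (closureTailProb R δ p - closureTailProb R δ p')
        rw [hδ]
      have hdeg : ∀ {p p' : ℝ}, p ≤ p' → p' ≤ R.mark 3 → R.mark 1 ≤ p →
          contTail R g p - contTail R g p' = 0 → ∀ δ,
            c δ * (closureTailProb R δ p - closureTailProb R δ p') = 0 := by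
        intro p p' hpp' hp' hp h0 δ
        rcases hpp'.eq_or_lt with rfl | hlt
        · simp
        · exact absurd h0 (ne_of_gt (sub_pos.2 (hCa ⟨hp, hpp'.trans hp'⟩
            ⟨hp.trans hpp', hp'⟩ hlt)))
      have hus := eventually_abs_sub_le_of_tendsto hε₀pos hCs (hwin hσ hs hss' hs')
        (hdeg hss' (hs'.trans hσ.2.2.1.le) (hσ.1.le.trans hs))
      have hut := eventually_abs_sub_le_of_tendsto hε₀pos hCt' (hwin hτ ht htt' ht')
        (hdeg htt' (ht'.trans hτ.2.2.1.le) (hτ.1.le.trans ht))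
      filter_upwards [hus, hut] with δ hu hu'
      have hQs : 0 ≤ closureTailProb R δ s - closureTailProb R δ s' :=
        sub_nonneg.2 (closureTailProb_antitone R δ (hσ.1.le.trans hs) hss'
          (hs'.trans hσ.2.2.1.le))
      have hQt : 0 ≤ closureTailProb R δ t - closureTailProb R δ t' :=
        sub_nonneg.2 (closureTailProb_antitone R δ (hτ.1.le.trans ht) htt'
          (ht'.trans hτ.2.2.1.le))
      -- the trivial law for `(ΔQ^cl, c δ ΔQ^cl)`
      have hδ' : |(closureTailProb R δ s - closureTailProb R δ s') *
            (c δ * (closureTailProb R δ t - closureTailProb R δ t')) -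
          (closureTailProb R δ t - closureTailProb R δ t') *
            (c δ * (closureTailProb R δ s - closureTailProb R δ s'))| ≤
          ε₀ * ((closureTailProb R δ s - closureTailProb R δ s') *
            (c δ * (closureTailProb R δ t - closureTailProb R δ t')) +
          (closureTailProb R δ t - closureTailProb R δ t') *
            (c δ * (closureTailProb R δ s - closureTailProb R δ s'))) := by
        have h0 : (closureTailProb R δ s - closureTailProb R δ s') *
            (c δ * (closureTailProb R δ t - closureTailProb R δ t')) -
          (closureTailProb R δ t - closureTailProb R δ t') *
            (c δ * (closureTailProb R δ s - closureTailProb R δ s')) = 0 := by ring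
        rw [h0, abs_zero]
        have hc := (hcpos δ).le
        positivity
      have := doubleRatio_transfer hQs hQt hCs hCt' hε₀pos.le hε₀1 hδ' hu hu'
      refine this.trans ?_
      have hS : 0 ≤ (closureTailProb R δ s - closureTailProb R δ s') *
          (contTail R g t - contTail R g t') +
          (closureTailProb R δ t - closureTailProb R δ t') * (contTail R g s - contTail R g s') := by
        positivity
      nlinarith
  -- at `s = mark 2`: `Q^cl_δ(mark 2) → C(mark 2) = F(crossRatio x)`
  have hQ : Tendsto (fun δ => closureTailProb R δ (R.mark 2)) (𝓝[>] 0)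
      (𝓝 (contTail R g (R.mark 2))) := by
    have := (key (R.mark 2) (mark_two_mem_Icc R)).add
      (tendsto_const_nhds (x := contTail R g (R.mark 2)))
    simpa only [sub_add_cancel, zero_add] using this
  have hx2 : contTail R g (R.mark 2) = cardyFunction (crossRatio x) := by
    unfold contTail
    congr 2
    funext i
    fin_cases i <;> rfl
  rw [hx2] at hQ
  rw [ConformalRectangle.crossRatio_eq_of_isUniformizing_holds hφx' hU]
  exact hQ.congr fun δ => closureTailProb_mark_two R δ

/-- **The crux from the closure density law.** `RectilinearCardy` follows from the lever of line
`excursion-kernel-covariance` (closure Cardy on flat-marked rectilinear rectangles by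
`closureCardy_of_flatMarks'`, on all rectilinear rectangles by `stub_closureFlatMarksReduction`, the
conjunct by `stub_closureToConjunct`). [folklore] -/
theorem rectilinearCardy_of_closureDensityAsymptoticsG
    (hA : ∀ R : ConformalRectangle, IsRectilinear R → FlatMarks R →
        ∀ (U : Set ℂ) (w : ℂ → ℂ), IsOpen U → R.carrier ⊆ U →
          R.pt 0 ∈ U → R.pt 1 ∈ U → R.pt 3 ∈ U →
          DifferentiableOn ℂ w U → BijOn w R.carrier {z : ℂ | 0 < z.im} →
          ∀ (g : ℝ → ℝ) (S₀ S : ℝ), S₀ < 0 → R.mark 3 < S →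
            (StrictMonoOn g (Icc S₀ S) ∨ StrictAntiOn g (Icc S₀ S)) →
            (∀ t ∈ Icc S₀ S, R.boundary t ∈ U → w (R.boundary t) = g t) →
          ∃ N : ℝ → ℝ, (∀ δ, 0 < N δ) ∧
            ∀ σ σ' : ℝ, AdmissibleRange R σ σ' → R.boundary '' Icc σ σ' ⊆ U →
              (∀ τ ∈ Icc σ σ', w (R.boundary τ) ≠ w (R.pt 0) ∧ w (R.boundary τ) ≠ w (R.pt 1) ∧
                w (R.boundary τ) ≠ w (R.pt 3)) →
              ∀ ε : ℝ, 0 < ε → ∀ᶠ δ in 𝓝[>] (0 : ℝ), ∀ v ∈ boundaryRow R δ, ∀ τ ∈ Icc σ σ',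
                dist (meshPoint δ v) (R.boundary τ) ≤ 4 * δ →
                  |closureDensity R δ v / (δ * N δ) -
                      ‖deriv w (R.boundary τ)‖ *
                        (‖w (R.boundary τ) - w (R.pt 0)‖ ^ 2 * ‖w (R.boundary τ) - w (R.pt 1)‖ ^ 2 *
                            ‖w (R.boundary τ) - w (R.pt 3)‖ ^ 2) ^ (-(1 / 3 : ℝ))| ≤ ε) :
    RectilinearCardy := fun R _ =>
  stub_closureToConjunct
    (stub_closureFlatMarksReduction stub_boundaryCorrespondence (closureCardy_of_flatMarks' hA)) R

end Summit.CriticalPhenomena.CardyFormulaZ2.Cruxes.RectilinearCardy.ExcursionKernelCovariance
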